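import Literature.Analysis.FluidPDE.SelfSimilarEulerStagnationStretching
import HarnessLib

/-!
# Every nontrivial self-similar Euler profile (`γ ≠ ½`) has a stagnation point with stretching `≥ 1`

Analysis/FluidPDE proofs file (theorems only), extension of `SelfSimilarEulerStagnationStretching`
(Constantin–Ignatova–Vicol 2026, arXiv:2602.17570, §3.5, Eulerian treatment) to ALL similarity
exponents `γ > 0`, `γ ≠ ½` — in particular to CIV's "admissible" regime `γ > ½`, where
self-similar blow-up is not excluded. The only place the window `γ < ½` entered the weighted
`L^{2a}` vorticity argument was the sign of the Bernoulli weight: `V·∇ℋ = (2γ−1)|V|²` (CIV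
(3.31)). Choosing the multiplier `λ' = −K/((2γ−1)c♭²)` of EITHER sign makes `λ'(2γ−1) = −K/c♭² < 0`,
so the same bracket closes for `γ > ½` with the weight `e^{λ'ℋ}`, `λ' < 0` (there `ℋ` INCREASES
along the flow).

> **Theorem** (`IsSelfSimilarEulerProfile.exists_stagnation_stretching_ge_one_of_ne_half`). Let
> `γ > 0`, `γ ≠ ½`, and let `(U, P)` be a NONTRIVIAL `C²` stationary self-similar Euler profile
> (CIV (3.3)) with the far-field bounds (3.8). Then there are a stagnation point `z` of
> `V = γ(y − c) + U` and `w ≠ 0` with `⟪DU(z) w, w⟫ ≥ |w|²`: the strain at `z` has an eigenvalue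
> `≥ 1`.

(For `γ < ½` this is `exists_stagnation_stretching_ge_one`; at `γ = ½` the Bernoulli function is
constant along the flow and the method gives nothing.) Compare CIV Prop. 3.3 (tree
`stretching_eq_one_of_isMaxOn`: stretching EQUALS one at the maximum of `|Ω|`, for every `γ`).

* `curl_eq_zero_of_stagnation_stretching_le_of_ne_half` — the core (uniform node bound
  `θ₀ < 1`, eventual outward radial transport, `γ ≠ ½`);
* `eq_zero_of_stagnation_stretching_lt_one_of_ne_half`, `exists_stagnation_stretching_ge_one_of_ne_half`.

## References

* P. Constantin, M. Ignatova, V. Vicol, arXiv:2602.17570 (2026), §3.2 Prop. 3.3, §3.4.3 (3.31),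
  §3.5. [ConstantinIgnatovaVicol2026Putative]
-/

noncomputable section

open MeasureTheory Set Filter Function Topology InnerProductSpace Metric
open scoped RealInnerProductSpace NNReal

namespace Literature.Analysis.FluidPDE

namespace IsSelfSimilarEulerProfile

variable {γ : ℝ} {c : EuclideanSpace ℝ (Fin 3)}
  {U : EuclideanSpace ℝ (Fin 3) → EuclideanSpace ℝ (Fin 3)} {P : EuclideanSpace ℝ (Fin 3) → ℝ}

/-- **Core, all exponents `γ ≠ ½`.** Let `γ > 0`, `γ ≠ ½`, `(U, P)` a `C²` profile (CIV (3.3)) with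
`⟪DU(z) w, w⟫ ≤ θ₀|w|²` (`θ₀ < 1`) at every stagnation point `z` of `V = γ(y−c) + U` and eventually
outward radial transport (`⟪V(y), y − c⟫ ≥ 0` for `|y − c| ≥ R₀`). Then `curl U = 0`. Proof: as
`curl_eq_zero_of_stagnation_stretching_le_of_outward`, with the Bernoulli multiplier
`λ' = −(2aM + 3γ + 1)/((2γ − 1)c♭²)` (of either sign), so that `λ'(2γ−1) < 0`. [cite: ConstantinIgnatovaVicol2026Putative, §3.5 Thm. 3.10 (proof, sharpened; all exponents)] -/
theorem curl_eq_zero_of_stagnation_stretching_le_of_ne_half (h : IsSelfSimilarEulerProfile γ c U P)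
    (hγ : 0 < γ) (hγ2 : γ ≠ 1 / 2) {θ₀ : ℝ} (hθ₀ : θ₀ < 1)
    (hnode : ∀ z ∈ selfSimilarNodalSet γ c U, ∀ w : EuclideanSpace ℝ (Fin 3),
      ⟪fderiv ℝ U z w, w⟫ ≤ θ₀ * ‖w‖ ^ 2)
    {R₀ : ℝ} (hR₀ : 0 < R₀)
    (hfarout : ∀ y, R₀ ≤ ‖y - c‖ → 0 ≤ ⟪selfSimilarTransport γ c U y, y - c⟫) :
    curl U = 0 := by
  classical
  have hU2 : ContDiff ℝ 2 U := h.contDiff_velocity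
  have hUd : Differentiable ℝ U := hU2.differentiable (by norm_num)
  have hDUc : Continuous (fderiv ℝ U) := hU2.continuous_fderiv (by norm_num)
  have hVp := h.isSelfSimilarEulerVorticityProfile
  set V : EuclideanSpace ℝ (Fin 3) → EuclideanSpace ℝ (Fin 3) := selfSimilarTransport γ c U
    with hVdef
  have hVc : Continuous V := by
    have : Continuous fun y : EuclideanSpace ℝ (Fin 3) => γ • (y - c) + U y :=
      ((continuous_id.sub continuous_const).const_smul γ).add hU2.continuous
    exact this
  set N : Set (EuclideanSpace ℝ (Fin 3)) := selfSimilarNodalSet γ c U with hNdef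
  -- (1) a neighbourhood `D` of the nodal set where `⟪DU w, w⟫ ≤ θ|w|²`, `θ = (1+θ₀)/2 < 1`
  set θ : ℝ := (1 + θ₀) / 2 with hθdef
  have hθ1 : θ < 1 := by rw [hθdef]; linarith
  have hrad : ∀ z ∈ N, ∃ r : ℝ, 0 < r ∧ ∀ y, dist y z < r →
      ∀ w : EuclideanSpace ℝ (Fin 3), ⟪fderiv ℝ U y w, w⟫ ≤ θ * ‖w‖ ^ 2 := by
    intro z hz
    have hδ : 0 < (1 - θ₀) / 2 := by linarith
    obtain ⟨r, hr, hball⟩ := Metric.continuousAt_iff.1 (hDUc.continuousAt (x := z)) _ hδ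
    refine ⟨r, hr, fun y hy w => ?_⟩
    have hn : ‖fderiv ℝ U y - fderiv ℝ U z‖ < (1 - θ₀) / 2 := by
      rw [← dist_eq_norm]; exact hball hy
    have h1 : ⟪(fderiv ℝ U y - fderiv ℝ U z) w, w⟫ ≤ (1 - θ₀) / 2 * ‖w‖ ^ 2 := by
      calc ⟪(fderiv ℝ U y - fderiv ℝ U z) w, w⟫
          ≤ ‖(fderiv ℝ U y - fderiv ℝ U z) w‖ * ‖w‖ := real_inner_le_norm _ _
        _ ≤ ‖fderiv ℝ U y - fderiv ℝ U z‖ * ‖w‖ * ‖w‖ :=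
            mul_le_mul_of_nonneg_right (ContinuousLinearMap.le_opNorm _ _) (norm_nonneg _)
        _ ≤ (1 - θ₀) / 2 * ‖w‖ * ‖w‖ := by gcongr
        _ = (1 - θ₀) / 2 * ‖w‖ ^ 2 := by ring
    have h2 := hnode z hz w
    have e : ⟪fderiv ℝ U y w, w⟫ = ⟪fderiv ℝ U z w, w⟫ + ⟪(fderiv ℝ U y - fderiv ℝ U z) w, w⟫ := by
      rw [show (fderiv ℝ U y - fderiv ℝ U z) w = fderiv ℝ U y w - fderiv ℝ U z w from rfl,
        inner_sub_left]
      ring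
    rw [e, hθdef]
    linarith
  choose! r hr hrD using hrad
  set D : Set (EuclideanSpace ℝ (Fin 3)) := ⋃ z ∈ N, ball z (r z) with hDdef
  have hDo : IsOpen D := isOpen_biUnion fun z _ => isOpen_ball
  have hND : N ⊆ D := fun z hz => mem_biUnion hz (mem_ball_self (hr z hz))
  have hDθ : ∀ y ∈ D, ∀ w : EuclideanSpace ℝ (Fin 3), ⟪fderiv ℝ U y w, w⟫ ≤ θ * ‖w‖ ^ 2 := by
    intro y hy w
    obtain ⟨z, hz, hyz⟩ := mem_iUnion₂.1 hy
    exact hrD z hz y (mem_ball.1 hyz) w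
  set a : ℝ := 1 + (3 * γ + 1) / (2 * (1 - θ)) with hadef
  have ha1 : 1 ≤ a := by
    rw [hadef]
    have : 0 ≤ (3 * γ + 1) / (2 * (1 - θ)) := by
      apply div_nonneg <;> linarith
    linarith
  have haθ : 2 * a * (θ - 1) + 3 * γ ≤ -1 := by
    have h1θ : 0 < 1 - θ := by linarith
    have hne : 2 * (1 - θ) ≠ 0 := by positivity
    have e : 2 * a * (1 - θ) = 2 * (1 - θ) + (3 * γ + 1) := by
      calc 2 * a * (1 - θ) = 2 * (1 - θ) + (3 * γ + 1) / (2 * (1 - θ)) * (2 * (1 - θ)) := by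
            rw [hadef]; ring
        _ = 2 * (1 - θ) + (3 * γ + 1) := by rw [div_mul_cancel₀ _ hne]
    nlinarith
  -- (4) for every radius `R ≥ R₀`, `Ω = 0` on `B̄(c, R)`
  have hball : ∀ R, R₀ ≤ R → ∀ y, ‖y - c‖ ≤ R → curl U y = 0 := by
    intro R hRR
    have hR : 0 < R := hR₀.trans_le hRR
    set K : Set (EuclideanSpace ℝ (Fin 3)) := closedBall c (2 * R) ∩ Dᶜ with hKdef
    have hKc : IsCompact K := (isCompact_closedBall c (2 * R)).inter_right hDo.isClosed_compl
    have hVpos : ∀ y ∈ K, 0 < ‖V y‖ := by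
      intro y hy
      rw [norm_pos_iff]
      intro hV0
      have hyN : y ∈ N := hV0
      exact hy.2 (hND hyN)
    obtain ⟨cfl, hcfl, hcflle⟩ := hKc.exists_forall_le' hVc.norm.continuousOn hVpos
    obtain ⟨M₀, hM₀⟩ := (isCompact_closedBall c (2 * R)).exists_bound_of_continuousOn
      hDUc.continuousOn
    set M : ℝ := max M₀ 1 with hMdef
    have hM : ∀ y, ‖y - c‖ ≤ 2 * R → ‖fderiv ℝ U y‖ ≤ M := fun y hy =>
      (hM₀ y (by rw [mem_closedBall, dist_eq_norm]; exact hy)).trans (le_max_left _ _)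
    -- `λ' (2γ−1) = −(2aM + 3γ + 1)/c♭²`, whatever the sign of `2γ − 1`
    set lam : ℝ := -(2 * a * M + 3 * γ + 1) / ((2 * γ - 1) * cfl ^ 2) with hlamdef
    have h2γ : 2 * γ - 1 ≠ 0 := by intro h0; apply hγ2; linarith
    have hcfl2 : 0 < cfl ^ 2 := by positivity
    have hlamprod : lam * (2 * γ - 1) = -(2 * a * M + 3 * γ + 1) / cfl ^ 2 := by
      rw [hlamdef, eq_div_iff hcfl2.ne']
      field_simp
    have hlamneg : lam * (2 * γ - 1) ≤ 0 := by
      rw [hlamprod]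
      apply div_nonpos_of_nonpos_of_nonneg _ hcfl2.le
      have : 0 ≤ 2 * a * M := by positivity
      linarith
    have hlamK : 2 * a * (M - 1) + lam * ((2 * γ - 1) * cfl ^ 2) + 3 * γ ≤ -1 := by
      have e : lam * ((2 * γ - 1) * cfl ^ 2) = -(2 * a * M + 3 * γ + 1) := by
        rw [← mul_assoc, hlamprod, div_mul_cancel₀ _ hcfl2.ne']
      rw [e]
      have : 0 ≤ 2 * a := by linarith
      nlinarith
    set ψ : EuclideanSpace ℝ (Fin 3) → ℝ := fun y => lam * selfSimilarBernoulli γ c U P y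
      with hψdef
    have hH1 := h.contDiff_selfSimilarBernoulli
    have hψ1 : ContDiff ℝ 1 ψ := contDiff_const.mul hH1
    have hψV : ∀ y, fderiv ℝ ψ y (V y) = lam * ((2 * γ - 1) * ‖V y‖ ^ 2) := by
      intro y
      have hHd : DifferentiableAt ℝ (selfSimilarBernoulli γ c U P) y :=
        hH1.differentiable one_ne_zero y
      rw [hψdef, fderiv_const_mul hHd, _root_.smul_apply, smul_eq_mul, hVdef,
        h.fderiv_selfSimilarBernoulli_transport y]
    set m : EuclideanSpace ℝ (Fin 3) → ℝ := fun y => if y ∈ D then θ else M with hmdef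
    have hm : ∀ y, ‖y - c‖ ≤ 2 * R →
        ⟪curl U y, fderiv ℝ U y (curl U y)⟫ ≤ m y * ‖curl U y‖ ^ 2 := by
      intro y hy
      by_cases hyD : y ∈ D
      · have hmy : m y = θ := if_pos hyD
        rw [hmy, real_inner_comm]
        exact hDθ y hyD _
      · have hmy : m y = M := if_neg hyD
        rw [hmy]
        calc ⟪curl U y, fderiv ℝ U y (curl U y)⟫
            ≤ ‖curl U y‖ * ‖fderiv ℝ U y (curl U y)‖ := real_inner_le_norm _ _
          _ ≤ ‖curl U y‖ * (‖fderiv ℝ U y‖ * ‖curl U y‖) :=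
              mul_le_mul_of_nonneg_left (ContinuousLinearMap.le_opNorm _ _) (norm_nonneg _)
          _ ≤ ‖curl U y‖ * (M * ‖curl U y‖) := by gcongr; exact hM y hy
          _ = M * ‖curl U y‖ ^ 2 := by ring
    have hbr : ∀ y, ‖y - c‖ ≤ 2 * R →
        2 * a * (m y - 1) + fderiv ℝ ψ y (selfSimilarTransport γ c U y) + 3 * γ ≤ -1 := by
      intro y hy
      rw [← hVdef, hψV y]
      by_cases hyD : y ∈ D
      · have hmy : m y = θ := if_pos hyD
        rw [hmy]
        have hneg : lam * ((2 * γ - 1) * ‖V y‖ ^ 2) ≤ 0 := by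
          rw [← mul_assoc]
          exact mul_nonpos_of_nonpos_of_nonneg hlamneg (sq_nonneg _)
        linarith
      · have hmy : m y = M := if_neg hyD
        rw [hmy]
        have hyK : y ∈ K := ⟨by rw [mem_closedBall, dist_eq_norm]; exact hy, hyD⟩
        have hVy : cfl ≤ ‖V y‖ := hcflle y hyK
        have hsq : cfl ^ 2 ≤ ‖V y‖ ^ 2 := pow_le_pow_left₀ hcfl.le hVy 2
        have hmono : lam * ((2 * γ - 1) * ‖V y‖ ^ 2) ≤ lam * ((2 * γ - 1) * cfl ^ 2) := by
          rw [← mul_assoc, ← mul_assoc]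
          exact mul_le_mul_of_nonpos_left hsq hlamneg
        linarith
    have hout' : ∀ y, R ≤ ‖y - c‖ → 0 ≤ ⟪selfSimilarTransport γ c U y, y - c⟫ :=
      fun y hy => hfarout y (hRR.trans hy)
    exact hVp.curl_eq_zero_of_weight ha1 hψ1 hR hm hbr hout'
  funext y
  have := hball (max R₀ ‖y - c‖) (le_max_left _ _) y (le_max_right _ _)
  simpa using this

/-- **Pointwise form under the far-field bounds, all exponents `γ ≠ ½`.** Let `γ > 0`, `γ ≠ ½`,
`(U, P)` a `C²` profile with (3.8). If `⟪DU(z) w, w⟫ < |w|²` for every stagnation point `z` and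
every `w ≠ 0`, then `U = 0` (compactness of the stagnation set makes the bound uniform; the far
field gives outward transport, `DU → 0` and `U(c) = 0`). [cite: ConstantinIgnatovaVicol2026Putative, §3.5 Thm. 3.10 (proof, sharpened; all exponents)] -/
theorem eq_zero_of_stagnation_stretching_lt_one_of_ne_half (h : IsSelfSimilarEulerProfile γ c U P)
    (hγ : 0 < γ) (hγ2 : γ ≠ 1 / 2) (hfar : HasSelfSimilarFarField γ c U)
    (hnode : ∀ z ∈ selfSimilarNodalSet γ c U, ∀ w : EuclideanSpace ℝ (Fin 3), w ≠ 0 →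
      ⟪fderiv ℝ U z w, w⟫ < ‖w‖ ^ 2) : U = 0 := by
  obtain ⟨C, hC⟩ := hfar
  have hU2 : ContDiff ℝ 2 U := h.contDiff_velocity
  have hDUc : Continuous (fderiv ℝ U) := hU2.continuous_fderiv (by norm_num)
  set N : Set (EuclideanSpace ℝ (Fin 3)) := selfSimilarNodalSet γ c U with hNdef
  have hNc : IsCompact N := hC.isCompact_selfSimilarNodalSet hγ hU2.continuous
  set S : Set (EuclideanSpace ℝ (Fin 3)) := sphere 0 1 with hSdef
  have hSc : IsCompact S := isCompact_sphere 0 1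
  set F : EuclideanSpace ℝ (Fin 3) × EuclideanSpace ℝ (Fin 3) → ℝ :=
    fun p => 1 - ⟪fderiv ℝ U p.1 p.2, p.2⟫ with hFdef
  have hFc : Continuous F := by
    have h1 : Continuous fun p : EuclideanSpace ℝ (Fin 3) × EuclideanSpace ℝ (Fin 3) =>
        fderiv ℝ U p.1 p.2 :=
      (hDUc.comp continuous_fst).clm_apply continuous_snd
    exact continuous_const.sub (h1.inner continuous_snd)
  have hFpos : ∀ p ∈ N ×ˢ S, (0 : ℝ) < F p := by
    rintro ⟨z, w⟩ ⟨hz, hw⟩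
    have hw1 : ‖w‖ = 1 := by simpa [hSdef] using hw
    have hw0 : w ≠ 0 := by
      rw [← norm_ne_zero_iff, hw1]; exact one_ne_zero
    have := hnode z hz w hw0
    rw [hw1, one_pow] at this
    simp only [hFdef]
    linarith
  obtain ⟨a', ha', hle⟩ := (hNc.prod hSc).exists_forall_le' hFc.continuousOn hFpos
  have hθ₀ : 1 - a' < 1 := by linarith
  have hnode' : ∀ z ∈ N, ∀ w : EuclideanSpace ℝ (Fin 3),
      ⟪fderiv ℝ U z w, w⟫ ≤ (1 - a') * ‖w‖ ^ 2 := by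
    intro z hz w
    by_cases hw : w = 0
    · simp [hw]
    have hn : ‖w‖ ≠ 0 := norm_ne_zero_iff.2 hw
    set e : EuclideanSpace ℝ (Fin 3) := ‖w‖⁻¹ • w with he
    have he1 : ‖e‖ = 1 := by rw [he, norm_smul, norm_inv, norm_norm, inv_mul_cancel₀ hn]
    have heS : e ∈ S := by simpa [hSdef] using he1
    have h1 := hle (z, e) ⟨hz, heS⟩
    simp only [hFdef] at h1
    have hwe : w = ‖w‖ • e := by rw [he, smul_smul, mul_inv_cancel₀ hn, one_smul]
    have h2 : ⟪fderiv ℝ U z w, w⟫ = ‖w‖ ^ 2 * ⟪fderiv ℝ U z e, e⟫ := by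
      rw [hwe, map_smul, inner_smul_left, inner_smul_right, conj_trivial, norm_smul, norm_norm,
        he1, mul_one]
      ring
    rw [h2]
    nlinarith [sq_nonneg ‖w‖]
  obtain ⟨R₀, hR₀, hfarout⟩ := hC.exists_inner_transport_nonneg hγ
  have hcurl0 := h.curl_eq_zero_of_stagnation_stretching_le_of_ne_half hγ hγ2 hθ₀ hnode' hR₀ hfarout
  have hcurl : ∀ x, curl U x = 0 := fun x => congrFun hcurl0 x
  have hD := hC.tendsto_norm_fderiv hγ
  funext y
  rw [eq_of_curl_eq_zero_of_isDivFree_of_fderiv_tendsto_zero hU2 hcurl h.divFree hD y c,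
    hC.apply_center]
  rfl

/-- **Every nontrivial self-similar Euler profile with `γ ≠ ½` has a stagnation point with
stretching rate `≥ 1`.** `γ > 0`, `γ ≠ ½`, `C²` profile with (3.8), `U ≠ 0` ⇒ `∃ z ∈ 𝒩_V`,
`∃ w ≠ 0`, `⟪DU(z) w, w⟫ ≥ |w|²`. [cite: ConstantinIgnatovaVicol2026Putative, §3.5 (sharpened; all exponents; not in print)] -/
theorem exists_stagnation_stretching_ge_one_of_ne_half (h : IsSelfSimilarEulerProfile γ c U P)
    (hγ : 0 < γ) (hγ2 : γ ≠ 1 / 2) (hfar : HasSelfSimilarFarField γ c U) (hU : U ≠ 0) :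
    ∃ z ∈ selfSimilarNodalSet γ c U, ∃ w : EuclideanSpace ℝ (Fin 3), w ≠ 0 ∧
      ‖w‖ ^ 2 ≤ ⟪fderiv ℝ U z w, w⟫ := by
  by_contra hcon
  push Not at hcon
  exact hU (h.eq_zero_of_stagnation_stretching_lt_one_of_ne_half hγ hγ2 hfar
    fun z hz w hw => hcon z hz w hw)

end IsSelfSimilarEulerProfile

end Literature.Analysis.FluidPDE

end
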